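import Mathlib
import Summits.Ventures.PercRepro2.StrandSplit
import Summits.Ventures.PercRepro2.SeriesSplit

/-!
# Splitting closed cuts over parallel and series compositions (seat mine-b, cell pub-perc-repro2)

`SeparatesIn ends E₁ S s t` says that the edge set `S` separates `s` from `t` inside the part `E₁`
(the edges of `E₁` outside `S` do not carry `s` to `t`); `k` pairwise disjoint such sets among the
closed edges of `E₁` is the event `D₁ ≥ k` of the path-dual row B2* (MINE-B.md §8.2, the distance
to the connection event = the packing number of the closed cuts).  The combinatorics of the two
compositions, dual to `StrandSplit.lean` / `SeriesSplit.lean`: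

* parallel (parts sharing only the terminals): a set separates in the union iff it separates in
  both parts (`separatesIn_union_iff_par`), so `k` disjoint cuts of the union are `k` disjoint cuts
  of each part and conversely (`kDisj_sep_par_iff`): `D = min(D₁, D₂)`;
* series (parts sharing only a cut vertex): a set separates in the union iff it separates `s–v` in
  `E₁` or `v–t` in `E₂` (`separatesIn_union_iff_ser`), so `k` disjoint cuts of the union split as
  `j` in `E₁` and `k − j` in `E₂` (`kDisj_sep_ser_iff`): `D = D₁ + D₂`.
-/

open Finset

namespace Summit.Ventures.PercRepro2

section Separation

variable {V : Type*} {E : Type*} [DecidableEq E]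

/-- **`S` separates `s` from `t` inside the part `E₁`**: the edges of `E₁` outside `S` do not carry -/
def SeparatesIn (ends : E → Sym2 V) (E₁ S : Finset E) (s t : V) : Prop :=
  ¬ Carries ends (E₁ \ S) s t

/-- separation is increasing in the separating set -/
lemma incr_separatesIn (ends : E → Sym2 V) (E₁ : Finset E) (s t : V) :
    ReimerCube.Incr (fun S : Finset E => SeparatesIn ends E₁ S s t) := by
  intro S T hST hS hT
  apply hS
  exact Carries.mono (Finset.sdiff_subset_sdiff le_rfl hST) hT

/-- a part carrying `s` to `t` is not separated by the empty set -/
lemma not_separatesIn_empty {ends : E → Sym2 V} {E₁ : Finset E} {s t : V} (h : Carries ends E₁ s t) :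
    ¬ SeparatesIn ends E₁ ∅ s t := by
  intro hS
  apply hS
  rw [Finset.sdiff_empty]
  exact h

/-- only the part of `S` inside `E₁` matters -/
lemma separatesIn_inter (ends : E → Sym2 V) (E₁ S : Finset E) (s t : V) :
    SeparatesIn ends E₁ (S ∩ E₁) s t ↔ SeparatesIn ends E₁ S s t := by
  unfold SeparatesIn
  have h : E₁ \ (S ∩ E₁) = E₁ \ S := by
    ext e; simp only [Finset.mem_sdiff, Finset.mem_inter]; tauto
  rw [h]

/-- **parallel composition**: a set separates in the union iff it separates in both parts -/
lemma separatesIn_union_iff_par {ends : E → Sym2 V} {s t : V} (hst : s ≠ t) {E₁ E₂ : Finset E}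
    (hE : SharesOnlyTerminals ends s t E₁ E₂) (S : Finset E) :
    SeparatesIn ends (E₁ ∪ E₂) S s t ↔ SeparatesIn ends E₁ S s t ∧ SeparatesIn ends E₂ S s t := by
  constructor
  · intro h
    constructor
    · intro h₁; exact h (Carries.mono (Finset.sdiff_subset_sdiff Finset.subset_union_left le_rfl) h₁)
    · intro h₂; exact h (Carries.mono (Finset.sdiff_subset_sdiff Finset.subset_union_right le_rfl) h₂)
  · rintro ⟨h₁, h₂⟩ hc
    have hK : (E₁ ∪ E₂) \ S ⊆ E₁ ∪ E₂ := Finset.sdiff_subset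
    have e1 : (E₁ ∪ E₂) \ S ∩ E₁ = E₁ \ S := by
      ext e; simp only [Finset.mem_inter, Finset.mem_sdiff, Finset.mem_union]; tauto
    have e2 : (E₁ ∪ E₂) \ S ∩ E₂ = E₂ \ S := by
      ext e; simp only [Finset.mem_inter, Finset.mem_sdiff, Finset.mem_union]; tauto
    rcases carries_split hst hE hK hc with h | h
    · rw [e1] at h; exact h₁ h
    · rw [e2] at h; exact h₂ h

/-- **series composition**: a set separates `s` from `t` in the union iff it separates `s` from
the cut vertex in `E₁` or the cut vertex from `t` in `E₂` -/
lemma separatesIn_union_iff_ser {ends : E → Sym2 V} {s v t : V} {E₁ E₂ : Finset E}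
    (hE : SharesOnlyVertex ends v E₁ E₂) (hs : ∀ e ∈ E₂, s ∉ ends e) (ht : ∀ e ∈ E₁, t ∉ ends e)
    (hsv : s ≠ v) (htv : t ≠ v) (hst : s ≠ t) (S : Finset E) :
    SeparatesIn ends (E₁ ∪ E₂) S s t ↔ SeparatesIn ends E₁ S s v ∨ SeparatesIn ends E₂ S v t := by
  constructor
  · intro h
    by_contra hn
    rw [not_or] at hn
    obtain ⟨h₁, h₂⟩ := hn
    have h₁' : Carries ends (E₁ \ S) s v := by
      by_contra hc; exact h₁ hc
    have h₂' : Carries ends (E₂ \ S) v t := by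
      by_contra hc; exact h₂ hc
    apply h
    have e : (E₁ ∪ E₂) \ S = (E₁ \ S) ∪ (E₂ \ S) := by
      ext e; simp only [Finset.mem_sdiff, Finset.mem_union]; tauto
    rw [e]
    exact carries_union_trans h₁' h₂'
  · intro h hc
    have hK : (E₁ ∪ E₂) \ S ⊆ E₁ ∪ E₂ := Finset.sdiff_subset
    obtain ⟨h₁, h₂⟩ := carries_series_split hE hs ht hsv htv hst hK hc
    have e1 : (E₁ ∪ E₂) \ S ∩ E₁ = E₁ \ S := by
      ext e; simp only [Finset.mem_inter, Finset.mem_sdiff, Finset.mem_union]; tauto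
    have e2 : (E₁ ∪ E₂) \ S ∩ E₂ = E₂ \ S := by
      ext e; simp only [Finset.mem_inter, Finset.mem_sdiff, Finset.mem_union]; tauto
    rw [e1] at h₁; rw [e2] at h₂
    rcases h with h | h
    · exact h h₁
    · exact h h₂

end Separation

section Packing

variable {E : Type*} [DecidableEq E]

omit [DecidableEq E] in
/-- `kDisj` is monotone in the predicate -/
lemma kDisj_mono_pred {A B : Finset E → Prop} (h : ∀ T, A T → B T) :
    ∀ (k : ℕ) {S : Finset E}, kDisj A k S → kDisj B k S
  | 0, _, _ => trivial
  | k + 1, S, hS => by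
      obtain ⟨K, L, hK, hL, hKL, hA, hB⟩ := hS
      exact ⟨K, L, hK, hL, hKL, fun T hT => h T (hA T hT),
        fun T hT => kDisj_mono_pred h k (hB T hT)⟩

/-- restricting `k` disjoint witnesses of `A` to a part gives `k` disjoint witnesses of an
increasing `B` when `A T` forces `B (T ∩ E₁)` -/
lemma kDisj_restrict {A B : Finset E → Prop} (hB : ReimerCube.Incr B) (E₁ : Finset E)
    (h : ∀ T, A T → B (T ∩ E₁)) :
    ∀ (k : ℕ) {S : Finset E}, kDisj A k S → kDisj B k (S ∩ E₁)
  | 0, _, _ => trivial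
  | k + 1, S, hS => by
      obtain ⟨K, L, hK, hL, hKL, hA, hBk⟩ := hS
      refine ⟨K ∩ E₁, L ∩ E₁, Finset.inter_subset_inter hK le_rfl, Finset.inter_subset_inter hL le_rfl,
        Finset.disjoint_of_subset_left Finset.inter_subset_left
          (Finset.disjoint_of_subset_right Finset.inter_subset_left hKL), ?_, ?_⟩
      · intro T hT
        exact hB hT (h K (hA K le_rfl))
      · intro T hT
        exact incr_kDisj B k hT (kDisj_restrict hB E₁ h k (hBk L le_rfl))

/-- zipping `k` disjoint witnesses in `E₁` with `k` disjoint witnesses in `E₂` (disjoint parts)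
gives `k` disjoint witnesses of a predicate `B` that holds on unions -/
lemma kDisj_zip {A₁ A₂ B : Finset E → Prop} (hB : ReimerCube.Incr B) {E₁ E₂ : Finset E}
    (hd : Disjoint E₁ E₂) (h : ∀ T₁ T₂, A₁ T₁ → A₂ T₂ → B (T₁ ∪ T₂)) :
    ∀ (k : ℕ) {S₁ S₂ : Finset E}, S₁ ⊆ E₁ → S₂ ⊆ E₂ → kDisj A₁ k S₁ → kDisj A₂ k S₂ →
      kDisj B k (S₁ ∪ S₂)
  | 0, _, _, _, _, _, _ => trivial
  | k + 1, S₁, S₂, hS₁, hS₂, h₁, h₂ => by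
      obtain ⟨K₁, L₁, hK₁, hL₁, hKL₁, hA₁, hB₁⟩ := h₁
      obtain ⟨K₂, L₂, hK₂, hL₂, hKL₂, hA₂, hB₂⟩ := h₂
      have hd' : Disjoint S₁ S₂ := Finset.disjoint_of_subset_left hS₁ (Finset.disjoint_of_subset_right hS₂ hd)
      refine ⟨K₁ ∪ K₂, L₁ ∪ L₂, Finset.union_subset_union hK₁ hK₂, Finset.union_subset_union hL₁ hL₂, ?_,
        fun T hT => hB hT (h K₁ K₂ (hA₁ K₁ le_rfl) (hA₂ K₂ le_rfl)),
        fun T hT => incr_kDisj B k hT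
          (kDisj_zip hB hd h k (hL₁.trans hS₁) (hL₂.trans hS₂) (hB₁ L₁ le_rfl) (hB₂ L₂ le_rfl))⟩
      rw [Finset.disjoint_union_left, Finset.disjoint_union_right, Finset.disjoint_union_right]
      exact ⟨⟨hKL₁, Finset.disjoint_of_subset_left hK₁ (Finset.disjoint_of_subset_right hL₂ hd')⟩,
        ⟨Finset.disjoint_of_subset_left hK₂ (Finset.disjoint_of_subset_right hL₁ hd'.symm), hKL₂⟩⟩

end Packing

section Compositions

variable {V : Type*} {E : Type*} [DecidableEq E]

/-- **parallel composition of closed cuts**: `k` disjoint cuts of the union inside `S ⊆ E₁ ∪ E₂` are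
`k` disjoint cuts of `E₁` inside `S ∩ E₁` and `k` disjoint cuts of `E₂` inside `S ∩ E₂`, and
conversely (`D = min(D₁, D₂)`) -/
theorem kDisj_sep_par_iff {ends : E → Sym2 V} {s t : V} (hst : s ≠ t) {E₁ E₂ : Finset E}
    (hE : SharesOnlyTerminals ends s t E₁ E₂) (hd : Disjoint E₁ E₂) (k : ℕ) {S : Finset E}
    (hS : S ⊆ E₁ ∪ E₂) :
    kDisj (fun T => SeparatesIn ends (E₁ ∪ E₂) T s t) k S ↔
      kDisj (fun T => SeparatesIn ends E₁ T s t) k (S ∩ E₁) ∧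
        kDisj (fun T => SeparatesIn ends E₂ T s t) k (S ∩ E₂) := by
  constructor
  · intro h
    constructor
    · refine kDisj_restrict (incr_separatesIn ends E₁ s t) E₁ ?_ k h
      intro T hT
      rw [separatesIn_inter]
      exact ((separatesIn_union_iff_par hst hE T).1 hT).1
    · refine kDisj_restrict (incr_separatesIn ends E₂ s t) E₂ ?_ k h
      intro T hT
      rw [separatesIn_inter]
      exact ((separatesIn_union_iff_par hst hE T).1 hT).2
  · rintro ⟨h₁, h₂⟩
    have hz := kDisj_zip (incr_separatesIn ends (E₁ ∪ E₂) s t) hd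
      (fun T₁ T₂ hT₁ hT₂ => (separatesIn_union_iff_par hst hE (T₁ ∪ T₂)).2
        ⟨incr_separatesIn ends E₁ s t Finset.subset_union_left hT₁,
         incr_separatesIn ends E₂ s t Finset.subset_union_right hT₂⟩)
      k Finset.inter_subset_right Finset.inter_subset_right h₁ h₂
    have hu : S ∩ E₁ ∪ S ∩ E₂ = S := by
      rw [← Finset.inter_union_distrib_left]
      exact Finset.inter_eq_left.2 hS
    rw [hu] at hz
    exact hz

/-- **series composition of closed cuts, splitting**: `k` disjoint cuts of the union inside
`S ⊆ E₁ ∪ E₂` give `j` disjoint `s–v` cuts of `E₁` inside `S ∩ E₁` and `k − j` disjoint `v–t` cuts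
of `E₂` inside `S ∩ E₂` -/
theorem kDisj_sep_ser_split {ends : E → Sym2 V} {s v t : V} {E₁ E₂ : Finset E}
    (hE : SharesOnlyVertex ends v E₁ E₂) (hs : ∀ e ∈ E₂, s ∉ ends e) (ht : ∀ e ∈ E₁, t ∉ ends e)
    (hsv : s ≠ v) (htv : t ≠ v) (hst : s ≠ t) :
    ∀ (k : ℕ) {S : Finset E}, kDisj (fun T => SeparatesIn ends (E₁ ∪ E₂) T s t) k S →
      ∃ j ≤ k, kDisj (fun T => SeparatesIn ends E₁ T s v) j (S ∩ E₁) ∧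
        kDisj (fun T => SeparatesIn ends E₂ T v t) (k - j) (S ∩ E₂)
  | 0, _, _ => ⟨0, le_rfl, trivial, trivial⟩
  | k + 1, S, h => by
      obtain ⟨K, L, hK, hL, hKL, hA, hB⟩ := h
      obtain ⟨j, hj, hL₁, hL₂⟩ := kDisj_sep_ser_split hE hs ht hsv htv hst k (hB L le_rfl)
      have hd : ∀ X : Finset E, Disjoint (K ∩ X) (L ∩ X) := fun X =>
        Finset.disjoint_of_subset_left Finset.inter_subset_left
          (Finset.disjoint_of_subset_right Finset.inter_subset_left hKL)
      rcases (separatesIn_union_iff_ser hE hs ht hsv htv hst K).1 (hA K le_rfl) with hK₁ | hK₂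
      · refine ⟨j + 1, by omega, ?_, ?_⟩
        · exact ⟨K ∩ E₁, L ∩ E₁, Finset.inter_subset_inter hK le_rfl, Finset.inter_subset_inter hL le_rfl,
            hd E₁, fun T hT => incr_separatesIn ends E₁ s v hT ((separatesIn_inter ends E₁ K s v).2 hK₁),
            fun T hT => incr_kDisj _ j hT hL₁⟩
        · have e : k + 1 - (j + 1) = k - j := by omega
          rw [e]
          exact incr_kDisj _ (k - j) (Finset.inter_subset_inter hL le_rfl) hL₂
      · refine ⟨j, by omega, incr_kDisj _ j (Finset.inter_subset_inter hL le_rfl) hL₁, ?_⟩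
        have e : k + 1 - j = (k - j) + 1 := by omega
        rw [e]
        exact ⟨K ∩ E₂, L ∩ E₂, Finset.inter_subset_inter hK le_rfl, Finset.inter_subset_inter hL le_rfl,
          hd E₂, fun T hT => incr_separatesIn ends E₂ v t hT ((separatesIn_inter ends E₂ K v t).2 hK₂),
          fun T hT => incr_kDisj _ (k - j) hT hL₂⟩

/-- **series composition of closed cuts, merging**: `j` disjoint `s–v` cuts of `E₁` and `k − j`
disjoint `v–t` cuts of `E₂` (disjoint parts) are `k` disjoint cuts of the union -/
theorem kDisj_sep_ser_merge {ends : E → Sym2 V} {s v t : V} {E₁ E₂ : Finset E}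
    (hE : SharesOnlyVertex ends v E₁ E₂) (hs : ∀ e ∈ E₂, s ∉ ends e) (ht : ∀ e ∈ E₁, t ∉ ends e)
    (hsv : s ≠ v) (htv : t ≠ v) (hst : s ≠ t) (i j : ℕ) {S₁ S₂ : Finset E} (hd : Disjoint S₁ S₂)
    (h₁ : kDisj (fun T => SeparatesIn ends E₁ T s v) i S₁)
    (h₂ : kDisj (fun T => SeparatesIn ends E₂ T v t) j S₂) :
    kDisj (fun T => SeparatesIn ends (E₁ ∪ E₂) T s t) (i + j) (S₁ ∪ S₂) := by
  have h₁' := kDisj_mono_pred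
    (fun T hT => (separatesIn_union_iff_ser hE hs ht hsv htv hst T).2 (Or.inl hT)) i h₁
  have h₂' := kDisj_mono_pred
    (fun T hT => (separatesIn_union_iff_ser hE hs ht hsv htv hst T).2 (Or.inr hT)) j h₂
  exact kDisj_merge i j hd h₁' h₂'

/-- **series composition of closed cuts** (`D = D₁ + D₂`) -/
theorem kDisj_sep_ser_iff {ends : E → Sym2 V} {s v t : V} {E₁ E₂ : Finset E}
    (hE : SharesOnlyVertex ends v E₁ E₂) (hs : ∀ e ∈ E₂, s ∉ ends e) (ht : ∀ e ∈ E₁, t ∉ ends e)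
    (hsv : s ≠ v) (htv : t ≠ v) (hst : s ≠ t) (hd : Disjoint E₁ E₂) (k : ℕ) {S : Finset E}
    (hS : S ⊆ E₁ ∪ E₂) :
    kDisj (fun T => SeparatesIn ends (E₁ ∪ E₂) T s t) k S ↔
      ∃ j ≤ k, kDisj (fun T => SeparatesIn ends E₁ T s v) j (S ∩ E₁) ∧
        kDisj (fun T => SeparatesIn ends E₂ T v t) (k - j) (S ∩ E₂) := by
  constructor
  · exact kDisj_sep_ser_split hE hs ht hsv htv hst k
  · rintro ⟨j, hj, h₁, h₂⟩
    have hd' : Disjoint (S ∩ E₁) (S ∩ E₂) :=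
      Finset.disjoint_of_subset_left Finset.inter_subset_right
        (Finset.disjoint_of_subset_right Finset.inter_subset_right hd)
    have hm := kDisj_sep_ser_merge hE hs ht hsv htv hst j (k - j) hd' h₁ h₂
    have e : j + (k - j) = k := by omega
    have hu : S ∩ E₁ ∪ S ∩ E₂ = S := by
      rw [← Finset.inter_union_distrib_left]
      exact Finset.inter_eq_left.2 hS
    rw [e, hu] at hm
    exact hm

end Compositions

end Summit.Ventures.PercRepro2
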